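import Summits.ValiantsHypothesis.ValiantsHypothesis.Theorems.BarrierLeverSuccinctHittingSetsForVPExplicitGenerator
import Mathlib.Combinatorics.Nullstellensatz

/-!
# Route BarrierLever — items `IntegerBoxVanishingTransfer` (stmt-ValiantsHypothesis-20033) and
# `SuccinctHittingSetsIffIntegerSlice` (stmt-ValiantsHypothesis-20029), part 1/3:
# integer seed grids decide vanishing on `SmallCircuits`, and integer labels of Raz's universal
# circuit give integer polynomials of small `ℓ¹` norm

The COEFFICIENT AXIS of FSV Question 6 (crux `SuccinctHittingSetsForVP`,
stmt-ValiantsHypothesis-14610).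
FSV Lemma 14 (interpolation of `D ∘ gen` over a grid) run on the INTEGER grid `{-h, …, h}^q` of the
tree's explicit generator `JointGen.gen n b` (Raz's universal circuit, seed-degree `≤ 2n + 1`):

* §1 `totalDegree_aeval_gen_le` — `deg (D ∘ gen) ≤ deg D · (2n+1)`;
* §2 `eq_zero_of_eval_int_grid` — a polynomial of degree `≤ 2h` vanishing on `{-h..h}^ι` is zero
  (Combinatorial Nullstellensatz, Mathlib `MvPolynomial.eq_zero_of_eval_zero_at_prod_finset`);
* §3 `vanishes_of_vanishes_on_intSeedGrid` — a level-`a` distinguisher vanishing at `gen n b (y)`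
  for every INTEGER seed `|y_i| ≤ h`, `N^a (2n+1) ≤ 2h` (`N = binom(2n,n)`), vanishes on ALL of
  `SmallCircuits ℂ n b` (uses ONTO, `exists_seed_of_mem`); `integerSeedGrid_decides` = the box
  `N^a (n+1)`;
* §4a `L1` — the `ℓ¹` norm on `MvPolynomial σ ℤ` (subadditive, submultiplicative);
* §4b `baseVal_int` / `outVal_int` / `coeff_outVal_int` — with integer labels `|Y| ≤ h` every node
  of Raz's universal circuit computes an integer polynomial, the output has `ℓ¹ ≤ (M h)^(2r-1)`,
  `M = #BIdx`;
* §4c the definitions `intBox n B` (all coefficients integers of absolute value `≤ B`) and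
  `bnd n b h = ((n + n·wd n b) h)^(2n+1)` used by parts 2/3.

Parts 2/3 (`…IntegerBoxVanishingTransfer.lean`, `…SuccinctHittingSetsIffIntegerSlice.lean`) package
this into the two ledger items. Lean text authored by the cell planner seat `valiant-natproofs-p2`
(gen 6, HOME/IntSlice-p2g6.lean, kernel-checked rc 0; referee on-landing audit pending), ported by
the prover seat (namespace, docstrings, split only).

WHAT THIS IS NOT: nothing here decides Question 6 / crux stmt-14610; no statement about `VP` vs
`VNP`; the CKRST 2020 linear-bit-length natural proofs are cited context, not formalised.

References: [ForbesShpilkaVolk2018] Lemmas 13–14; Raz 2010 (universal circuits) via the tree file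
`RazUniversalCircuits`; Alon's Combinatorial Nullstellensatz (Mathlib).
-/

-- layout Summits/ValiantsHypothesis/ValiantsHypothesis forces the duplicated namespace component
set_option linter.dupNamespace false

noncomputable section

namespace Summit.ValiantsHypothesis.ValiantsHypothesis.Theorems.BarrierLever.IntSlice

open Literature.Barriers.ValiantsHypothesis Literature.Computability.AlgebraicComplexity
open MvPolynomial
open Summit.ValiantsHypothesis.ValiantsHypothesis.Theorems.BarrierLever.SuccinctHittingSetsForVP
open Summit.ValiantsHypothesis.ValiantsHypothesis.Theorems.BarrierLever.SuccinctHittingSetsForVP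
open Summit.ValiantsHypothesis.ValiantsHypothesis.Theorems.BarrierLever.SuccinctHittingSetsForVP.JointGen

/-! ### §1 Degree of a substitution -/

/-- Degree of a substitution: `deg (bind₁ h p) ≤ deg p · K` when every `h v` has degree `≤ K`. -/
theorem totalDegree_bind₁_le_mul {R : Type*} [CommSemiring R] {σ τ : Type*}
    {h : σ → MvPolynomial τ R} {K : ℕ} (hh : ∀ v, (h v).totalDegree ≤ K)
    (p : MvPolynomial σ R) : (bind₁ h p).totalDegree ≤ p.totalDegree * K := by
  classical
  conv_lhs => rw [p.as_sum, map_sum]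
  refine (totalDegree_finsetSum _ _).trans (Finset.sup_le fun m hm => ?_)
  rw [bind₁_monomial]
  refine (totalDegree_mul _ _).trans ?_
  rw [totalDegree_C, zero_add]
  change (∏ v ∈ m.support, h v ^ m v).totalDegree ≤ _
  refine (totalDegree_finsetProd _ _).trans ?_
  calc ∑ v ∈ m.support, (h v ^ m v).totalDegree ≤ ∑ v ∈ m.support, m v * K :=
        Finset.sum_le_sum fun v _ => (totalDegree_pow _ _).trans (Nat.mul_le_mul_left _ (hh v))
    _ = (m.sum fun _ e => e) * K := by rw [← Finset.sum_mul]; rfl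
    _ ≤ p.totalDegree * K := Nat.mul_le_mul_right _ (le_totalDegree hm)

/-- Every coordinate of the explicit generator has seed-degree `≤ 2n + 1` (Raz Prop. 3.2: `2k - 1`
on the block of degree `k ≥ 1`; the constant coordinate is a variable). -/
theorem totalDegree_gen_le (n b : ℕ) (m : degLEMonomials n) :
    (gen n b m).totalDegree ≤ 2 * n + 1 := by
  unfold gen gen₀
  refine (totalDegree_rename_le _ _).trans ?_
  split_ifs with h0
  · rw [totalDegree_X]; omega
  · refine (totalDegree_rename_le _ _).trans ((RazUniversal.totalDegree_uCoeff_le _).trans ?_)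
    have hk : ((lvl m : Fin (n + 1)) : ℕ) ≤ n := Nat.lt_succ_iff.mp (lvl m).isLt
    omega

/-- `deg (D ∘ gen) ≤ deg D · (2n + 1)`. -/
theorem totalDegree_aeval_gen_le {n b : ℕ} (D : MvPolynomial (degLEMonomials n) ℂ) :
    (aeval (gen n b) D).totalDegree ≤ D.totalDegree * (2 * n + 1) := by
  rw [aeval_eq_bind₁]
  exact totalDegree_bind₁_le_mul (totalDegree_gen_le n b) D

/-! ### §2 Interpolation over an integer grid -/

/-- A polynomial over `ℂ` of total degree `≤ 2h` vanishing at every INTEGER point of the box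
`{-h, …, h}^p` is zero (Combinatorial Nullstellensatz, Mathlib). -/
theorem eq_zero_of_eval_int_grid {ι : Type*} [Finite ι] (Q : MvPolynomial ι ℂ) (h : ℕ)
    (hdeg : Q.totalDegree ≤ 2 * h)
    (hgrid : ∀ y : ι → ℤ, (∀ i, |y i| ≤ h) → eval (fun i => (y i : ℂ)) Q = 0) : Q = 0 := by
  classical
  let S : ι → Finset ℂ := fun _ => (Finset.Icc (-(h : ℤ)) h).image (fun z : ℤ => (z : ℂ))
  refine eq_zero_of_eval_zero_at_prod_finset Q S (fun i => ?_) (fun x hx => ?_)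
  · have hcard : (S i).card = 2 * h + 1 := by
      simp only [S]
      rw [Finset.card_image_of_injective _ Int.cast_injective, Int.card_Icc]
      omega
    rw [hcard]
    exact Nat.lt_succ_of_le ((degreeOf_le_totalDegree Q i).trans hdeg)
  · choose y hy using fun i => Finset.mem_image.mp (hx i)
    have hx' : x = fun i => (y i : ℂ) := funext fun i => (hy i).2.symm
    rw [hx']
    exact hgrid y fun i => abs_le.mpr (Finset.mem_Icc.mp (hy i).1)

/-! ### §3 The integer seed grid decides the vanishing on `SmallCircuits ℂ n b` -/

/-- **Coefficient-axis collapse (seed form).** If a level-`a` distinguisher vanishes at the value of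
`gen n b` at every INTEGER seed of sup-norm `≤ N^a (n+1)`, then it vanishes on all of
`SmallCircuits ℂ n b`. [cite: ForbesShpilkaVolk2018, Lemma 14 (interpolation), Lemma 13 (onto)] -/
theorem vanishes_of_vanishes_on_intSeedGrid {n b a : ℕ} {D : MvPolynomial (degLEMonomials n) ℂ}
    (hD : D ∈ Distinguishers ℂ n a) {h : ℕ} (hh : (Nat.choose (2 * n) n) ^ a * (2 * n + 1) ≤ 2 * h)
    (hgrid : ∀ y : Fin (q n b) → ℤ, (∀ i, |y i| ≤ h) →
      eval (fun m => eval (fun i => (y i : ℂ)) (gen n b m)) D = 0) :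
    ∀ f ∈ SmallCircuits ℂ n b, eval (coeffVector (degLEMonomials n) f) D = 0 := by
  have hzero : aeval (gen n b) D = 0 := by
    refine eq_zero_of_eval_int_grid _ h ?_ (fun y hy => ?_)
    · calc (aeval (gen n b) D).totalDegree
          ≤ D.totalDegree * (2 * n + 1) := totalDegree_aeval_gen_le D
        _ ≤ (Nat.choose (2 * n) n) ^ a * (2 * n + 1) := Nat.mul_le_mul_right _ hD.2
        _ ≤ 2 * h := hh
    · rw [← Generator.eval_point_eq]; exact hgrid y hy
  intro f hf
  obtain ⟨y, hy⟩ := exists_seed_of_mem hf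
  have hpt : coeffVector (degLEMonomials n) f = fun m => eval y (gen n b m) :=
    funext fun m => by rw [coeffVector_apply, hy m]
  rw [hpt, Generator.eval_point_eq, hzero, map_zero]

/-- **The integer seed box decides** (typed over built decls): for every `n`, a level-`a`
distinguisher vanishing at `gen n b (y)` for all INTEGER seeds of sup-norm `≤ N^a (n+1)` vanishes
on `SmallCircuits ℂ n b`. -/
theorem integerSeedGrid_decides :
    ∀ a b n : ℕ, ∀ D ∈ Literature.Barriers.ValiantsHypothesis.Distinguishers ℂ n a,
      (∀ y : Fin (JointGen.q n b) → ℤ, (∀ i, |y i| ≤ ((Nat.choose (2 * n) n) ^ a * (n + 1) : ℕ)) →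
        MvPolynomial.eval
          (fun m => MvPolynomial.eval (fun i => (y i : ℂ)) (JointGen.gen n b m)) D = 0) →
      ∀ f ∈ Literature.Barriers.ValiantsHypothesis.SmallCircuits ℂ n b,
        MvPolynomial.eval (Literature.Barriers.ValiantsHypothesis.coeffVector
          (Literature.Barriers.ValiantsHypothesis.degLEMonomials n) f) D = 0 := by
  intro a b n D hD hgrid
  refine vanishes_of_vanishes_on_intSeedGrid hD (h := (Nat.choose (2 * n) n) ^ a * (n + 1)) ?_ hgrid
  ring_nf; omega

/-! ### §4a An `ℓ¹` norm on integer polynomials -/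

section L1

variable {σ : Type*}

/-- `ℓ¹` norm of the coefficient vector of an integer polynomial. -/
def L1 (P : MvPolynomial σ ℤ) : ℤ := ∑ e ∈ P.support, |coeff e P|

/-- `L1` is nonnegative. -/
theorem L1_nonneg (P : MvPolynomial σ ℤ) : 0 ≤ L1 P :=
  Finset.sum_nonneg fun _ _ => abs_nonneg _

/-- Partial sums of `|coeff|` over any finset are bounded by `L1`. -/
theorem sum_abs_coeff_le_L1 (P : MvPolynomial σ ℤ) (T : Finset (σ →₀ ℕ)) :
    ∑ e ∈ T, |coeff e P| ≤ L1 P := by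
  classical
  calc ∑ e ∈ T, |coeff e P| = ∑ e ∈ T.filter (· ∈ P.support), |coeff e P| := by
        rw [Finset.sum_filter]
        refine Finset.sum_congr rfl fun e _ => ?_
        split_ifs with he
        · rfl
        · rw [notMem_support_iff.mp he, abs_zero]
    _ ≤ ∑ e ∈ P.support, |coeff e P| :=
        Finset.sum_le_sum_of_subset_of_nonneg (fun e he => (Finset.mem_filter.mp he).2)
          fun _ _ _ => abs_nonneg _

/-- Every coefficient is bounded in absolute value by `L1`. -/
theorem abs_coeff_le_L1 (P : MvPolynomial σ ℤ) (e : σ →₀ ℕ) : |coeff e P| ≤ L1 P := by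
  classical
  have h := sum_abs_coeff_le_L1 P {e}
  rwa [Finset.sum_singleton] at h

/-- `L1 0 = 0`. -/
theorem L1_zero : L1 (0 : MvPolynomial σ ℤ) = 0 := by simp [L1]

/-- `L1` is subadditive. -/
theorem L1_add_le (P Q : MvPolynomial σ ℤ) : L1 (P + Q) ≤ L1 P + L1 Q := by
  classical
  calc L1 (P + Q) = ∑ e ∈ (P + Q).support, |coeff e P + coeff e Q| := by simp only [L1, coeff_add]
    _ ≤ ∑ e ∈ (P + Q).support, (|coeff e P| + |coeff e Q|) :=
        Finset.sum_le_sum fun e _ => abs_add_le _ _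
    _ = (∑ e ∈ (P + Q).support, |coeff e P|) + ∑ e ∈ (P + Q).support, |coeff e Q| :=
        Finset.sum_add_distrib
    _ ≤ L1 P + L1 Q := add_le_add (sum_abs_coeff_le_L1 P _) (sum_abs_coeff_le_L1 Q _)

/-- `L1` of a finite sum is at most the sum of the `L1`s. -/
theorem L1_sum_le {ι : Type*} (s : Finset ι) (P : ι → MvPolynomial σ ℤ) :
    L1 (∑ i ∈ s, P i) ≤ ∑ i ∈ s, L1 (P i) := by
  classical
  induction s using Finset.induction_on with
  | empty => simp [L1_zero]
  | insert i s hi ih =>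
    rw [Finset.sum_insert hi, Finset.sum_insert hi]
    exact (L1_add_le _ _).trans (add_le_add le_rfl ih)

/-- `L1 (c • P) ≤ |c| · L1 P`. -/
theorem L1_smul_le (c : ℤ) (P : MvPolynomial σ ℤ) : L1 (c • P) ≤ |c| * L1 P := by
  classical
  calc L1 (c • P) = ∑ e ∈ (c • P).support, |c| * |coeff e P| := by
        simp only [L1, coeff_smul, smul_eq_mul, abs_mul]
    _ = |c| * ∑ e ∈ (c • P).support, |coeff e P| := by rw [Finset.mul_sum]
    _ ≤ |c| * L1 P := mul_le_mul_of_nonneg_left (sum_abs_coeff_le_L1 P _) (abs_nonneg c)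

/-- `L1` of a monomial is at most the absolute value of its coefficient. -/
theorem L1_monomial_le (e : σ →₀ ℕ) (c : ℤ) : L1 (monomial e c) ≤ |c| := by
  classical
  unfold L1
  refine (Finset.sum_le_sum_of_subset_of_nonneg (support_monomial_subset)
    (fun _ _ _ => abs_nonneg _)).trans ?_
  rw [Finset.sum_singleton, coeff_monomial, if_pos rfl]

/-- `L1 (X t) ≤ 1`. -/
theorem L1_X_le (t : σ) : L1 (X t : MvPolynomial σ ℤ) ≤ 1 := by
  have h := L1_monomial_le (σ := σ) (Finsupp.single t 1) 1
  rwa [abs_one] at h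

/-- `L1` is submultiplicative. -/
theorem L1_mul_le (P Q : MvPolynomial σ ℤ) : L1 (P * Q) ≤ L1 P * L1 Q := by
  classical
  have hPQ : P * Q = ∑ e₁ ∈ P.support, ∑ e₂ ∈ Q.support,
      monomial (e₁ + e₂) (coeff e₁ P * coeff e₂ Q) := by
    conv_lhs => rw [P.as_sum, Q.as_sum, Finset.sum_mul_sum]
    refine Finset.sum_congr rfl fun e₁ _ => Finset.sum_congr rfl fun e₂ _ => ?_
    rw [monomial_mul]
  rw [hPQ]
  calc L1 (∑ e₁ ∈ P.support, ∑ e₂ ∈ Q.support, monomial (e₁ + e₂) (coeff e₁ P * coeff e₂ Q))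
      ≤ ∑ e₁ ∈ P.support, ∑ e₂ ∈ Q.support, |coeff e₁ P| * |coeff e₂ Q| := by
        refine (L1_sum_le _ _).trans (Finset.sum_le_sum fun e₁ _ => (L1_sum_le _ _).trans
          (Finset.sum_le_sum fun e₂ _ => (L1_monomial_le _ _).trans (abs_mul _ _).le))
    _ = L1 P * L1 Q := by rw [L1, L1, Finset.sum_mul_sum]

end L1

/-! ### §4b Integer labels: the universal circuit computes integer polynomials of small `ℓ¹` norm -/

section Values

open RazUniversal

variable {σ : Type*} {r N : ℕ}

/-- `#BIdx = #σ + r N`. -/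
theorem card_bIdx [Fintype σ] : Fintype.card (BIdx σ r N) = Fintype.card σ + r * N := by
  simp [Fintype.card_sum, Fintype.card_prod, Fintype.card_fin]

/-- `map ℤ → ℂ` of a weighted sum. -/
theorem map_sum_smul {ι : Type*} (s : Finset ι) (c : ι → ℤ) (P : ι → MvPolynomial σ ℤ) :
    MvPolynomial.map (Int.castRingHom ℂ) (∑ i ∈ s, c i • P i) =
      ∑ i ∈ s, ((c i : ℤ) : ℂ) • MvPolynomial.map (Int.castRingHom ℂ) (P i) := by
  rw [map_sum]
  refine Finset.sum_congr rfl fun i _ => ?_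
  rw [smul_eq_C_mul, smul_eq_C_mul, map_mul, map_C]
  rfl

/-- `ℓ¹` of a weighted sum with weights `|c_i| ≤ h` and `L1 (P i) ≤ B`. -/
theorem L1_sum_smul_le {ι : Type*} [Fintype ι] (c : ι → ℤ) (P : ι → MvPolynomial σ ℤ)
    {h B : ℤ} (_hB : 0 ≤ B) (hc : ∀ i, |c i| ≤ h) (hP : ∀ i, L1 (P i) ≤ B) :
    L1 (∑ i, c i • P i) ≤ Fintype.card ι * (h * B) := by
  calc L1 (∑ i, c i • P i) ≤ ∑ i, L1 (c i • P i) := L1_sum_le _ _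
    _ ≤ ∑ _i : ι, h * B := Finset.sum_le_sum fun i _ => (L1_smul_le _ _).trans
        (mul_le_mul (hc i) (hP i) (L1_nonneg _) ((abs_nonneg _).trans (hc i)))
    _ = Fintype.card ι * (h * B) := by
        rw [Finset.sum_const, Finset.card_univ, nsmul_eq_mul]

variable [Fintype σ]

/-- **Integrality and size of the node values.** With INTEGER labels of absolute value `≤ h`, every
node of level `d` of Raz's universal circuit computes (the image of) an integer polynomial of
`ℓ¹` norm `≤ (M h)^(2d-2)`, `M = #BIdx`. -/
theorem baseVal_int (Y : Lab σ r N → ℤ) (h : ℕ) (hY : ∀ l, |Y l| ≤ h) :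
    ∀ (d : ℕ) (dd : Fin (r + 1)), (dd : ℕ) = d → ∀ b : BIdx σ r N,
      ∃ P : MvPolynomial σ ℤ,
        baseVal (fun l => (Y l : ℂ)) dd b = MvPolynomial.map (Int.castRingHom ℂ) P ∧
        L1 P ≤ ((Fintype.card (BIdx σ r N) * h : ℕ) : ℤ) ^ (2 * d - 2) := by
  intro d
  induction d using Nat.strong_induction_on with
  | _ d ih =>
  intro dd hdd b
  set K : ℤ := ((Fintype.card (BIdx σ r N) * h : ℕ) : ℤ) with hK
  have hK0 : 0 ≤ K := by positivity
  rcases b with t | ⟨j, k⟩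
  · rw [baseVal_inl]
    split_ifs with h1
    · refine ⟨X t, by rw [map_X], (L1_X_le t).trans ?_⟩
      have : 2 * d - 2 = 0 := by omega
      rw [this, pow_zero]
    · exact ⟨0, by rw [map_zero], by rw [L1_zero]; positivity⟩
  · by_cases hjk : 1 ≤ (j : ℕ) ∧ (j : ℕ) < (dd : ℕ)
    · rw [baseVal_inr _ dd j k hjk]
      have ihj := ih (j : ℕ) (by omega) (Fin.castSucc j) (by simp)
      have ihd := ih (d - j) (by omega) ⟨(dd : ℕ) - j, by have := dd.isLt; omega⟩ (by simp [hdd])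
      choose P hP hPB using ihj
      choose Q hQ hQB using ihd
      refine ⟨(∑ b, Y (Sum.inl (dd, j, k, false, b)) • P b) *
          (∑ b, Y (Sum.inl (dd, j, k, true, b)) • Q b), ?_, ?_⟩
      · rw [map_mul, map_sum_smul, map_sum_smul]
        congr 1
        · exact Finset.sum_congr rfl fun b _ => by rw [hP b]
        · exact Finset.sum_congr rfl fun b _ => by rw [hQ b]
      · refine (L1_mul_le _ _).trans ?_
        have h1 := L1_sum_smul_le (fun b => Y (Sum.inl (dd, j, k, false, b))) P
          (pow_nonneg hK0 _) (fun b => hY _) hPB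
        have h2 := L1_sum_smul_le (fun b => Y (Sum.inl (dd, j, k, true, b))) Q
          (pow_nonneg hK0 _) (fun b => hY _) hQB
        refine (mul_le_mul h1 h2 (L1_nonneg _) ((L1_nonneg _).trans h1)).trans ?_
        have hKdef : (Fintype.card (BIdx σ r N) : ℤ) * (h : ℤ) = K := by rw [hK]; push_cast; ring
        calc (Fintype.card (BIdx σ r N) : ℤ) * ((h : ℤ) * K ^ (2 * (j : ℕ) - 2)) *
              ((Fintype.card (BIdx σ r N) : ℤ) * ((h : ℤ) * K ^ (2 * (d - j) - 2)))
            = K ^ (2 * (j : ℕ) - 2 + 1) * K ^ (2 * (d - j) - 2 + 1) := by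
              rw [← hKdef]; ring
          _ ≤ K ^ (2 * d - 2) := by
              rw [← pow_add]
              apply le_of_eq
              congr 1
              omega
    · rw [baseVal_inr_of_not _ dd j k hjk]
      exact ⟨0, by rw [map_zero], by rw [L1_zero]; positivity⟩

/-- **The output**: with integer labels `|Y| ≤ h`, `OUT(Y)` is an integer polynomial of `ℓ¹` norm
`≤ (M h)^(2r-1)`. -/
theorem outVal_int (hr : 1 ≤ r) (Y : Lab σ r N → ℤ) (h : ℕ) (hY : ∀ l, |Y l| ≤ h) :
    ∃ P : MvPolynomial σ ℤ, outVal (fun l => (Y l : ℂ)) = MvPolynomial.map (Int.castRingHom ℂ) P ∧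
      L1 P ≤ ((Fintype.card (BIdx σ r N) * h : ℕ) : ℤ) ^ (2 * r - 1) := by
  have hb := baseVal_int Y h hY r (Fin.last r) (by simp)
  choose P hP hPB using hb
  refine ⟨∑ b, Y (Sum.inr b) • P b, ?_, ?_⟩
  · rw [outVal_eq, map_sum_smul]
    exact Finset.sum_congr rfl fun b _ => by rw [hP b]
  · have hK0 : (0 : ℤ) ≤ ((Fintype.card (BIdx σ r N) * h : ℕ) : ℤ) := by positivity
    refine (L1_sum_smul_le _ P (pow_nonneg hK0 _) (fun b => hY _) hPB).trans (le_of_eq ?_)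
    have : 2 * r - 1 = (2 * r - 2) + 1 := by omega
    rw [this, pow_succ]
    push_cast
    ring

/-- **Coefficients**: integers of absolute value `≤ (M h)^(2r-1)`. -/
theorem coeff_outVal_int (hr : 1 ≤ r) (Y : Lab σ r N → ℤ) (h : ℕ) (hY : ∀ l, |Y l| ≤ h)
    (e : σ →₀ ℕ) :
    ∃ z : ℤ, coeff e (outVal (fun l => (Y l : ℂ))) = z ∧
      |z| ≤ ((Fintype.card (BIdx σ r N) * h : ℕ) : ℤ) ^ (2 * r - 1) := by
  obtain ⟨P, hP, hB⟩ := outVal_int hr Y h hY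
  exact ⟨coeff e P, by rw [hP, coeff_map]; rfl, (abs_coeff_le_L1 P e).trans hB⟩

end Values

/-! ### §4c The integer box slice (definitions; used in parts 2/3) -/

/-- The INTEGER BOX slice: polynomials all of whose coefficients are integers of absolute value `≤ B`. -/
def intBox (n B : ℕ) : Set (MvPolynomial (Fin n) ℂ) :=
  {f | ∀ m : Fin n →₀ ℕ, ∃ z : ℤ, coeff m f = z ∧ |z| ≤ B}

/-- The uniform coefficient bound `((n + n·wd) h)^(2n+1)`. -/
def bnd (n b h : ℕ) : ℕ := ((n + n * wd n b) * h) ^ (2 * n + 1)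

/-- `intBox` is monotone in the bound. -/
theorem intBox_mono {n B B' : ℕ} (h : B ≤ B') : intBox n B ⊆ intBox n B' := fun f hf m => by
  obtain ⟨z, hz, hzB⟩ := hf m
  exact ⟨z, hz, hzB.trans (by exact_mod_cast h)⟩

end Summit.ValiantsHypothesis.ValiantsHypothesis.Theorems.BarrierLever.IntSlice

end
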